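import Mathlib
import Summits.ResolutionOfSingularities.ResolutionOfSingularities.Theorems.RadicialJungCleanModelsGenericSpreadTypeOne
import Summits.ResolutionOfSingularities.ResolutionOfSingularities.Theorems.RadicialJungCleanModelsContactChainSimpleContaining
import HarnessLib

/-!
# Route `RadicialJung`, crux `CleanModels` (stmt-ResolutionOfSingularities-15917), line `Sketch` rev 35, stub 6 `stub_cleanProp44` (X44c),
# work plan O8 / L7b-global, item (G1) for the clean types (1)-one-factor and (3): SPREADING a SIMPLE generic representative

Memo `Cruxes/CleanModels/Lines/Sketch-memo-hand2-g9-stubs-5-7.md` §3a (G1-types 1/3).  RING LEVEL, companion of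
✓ `exists_not_mem_forall_cleanPermissibleAt_of_generic_pair` (`…GenericSpreadTypeOne.lean`): `A` a domain, `𝔭` a prime, `B = A_𝔭` with
`K = Frac A`, `q₀, q₁ ∈ A` generating `𝔪_B`.  If the line of `G` has at `B` a representative `u · S₀^{a₀}` with `u ∈ B^×`, `p ∤ a₀` and `S₀` SIMPLE
(`S₀ ∈ 𝔪_B ∖ 𝔪_B²`) — the clean type (1) with one factor, or the shifted type (3) `s − c^p` (`u = 1`, `a₀ = 1`) — then off ONE element `g ∉ 𝔭`, at every
prime `𝔮 ⊇ 𝔭` where `A_𝔮` is regular and `(q₀, q₁)` is a regular pair generating `𝔭A_𝔮`, the line is CLEAN-PERMISSIBLE for `𝔭A_𝔮`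
(`exists_not_mem_forall_cleanPermissibleAt_of_generic_simple`): clear denominators, write `e S = l₀ q₀ + l₁ q₁` with some `l_j ∉ 𝔭`
(`S₀ ∉ 𝔪_B²`), and at `𝔮 ∌ e l_j …` the pair `(S, q_{1−j})` is a regular pair generating `𝔭A_𝔮` (✓ `span_pair_eq_of_unit_coeff`), so
✓ `cleanPermissibleAt_of_split` applies.

Honest framing: OURS (bookkeeping); nothing here proves X44c or any case of `CleanModels`.
-/

noncomputable section

set_option linter.dupNamespace false -- mandated namespace of this single-conjunct summit

open IsLocalRing Literature.AlgebraicGeometry.Resolution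

namespace Summit.ResolutionOfSingularities.ResolutionOfSingularities.Theorems.RadicialJung.CleanModels

/-- **Generic spreading of a simple clean representative along the curve (ring level).**  See the module docstring.
[cite: CossartPiltant2008, Prop. 4.4 (proof, p. 10)] [cite: Piltant2013, §2 Axiom 4] [cite: Matsumura1987, Thm. 14.2] -/
theorem exists_not_mem_forall_cleanPermissibleAt_of_generic_simple {A K : Type} [CommRing A] [IsDomain A] [Field K] [Algebra A K]
    [IsFractionRing A K] (p : ℕ) [hp : Fact p.Prime] (𝔭 : Ideal A) [h𝔭 : 𝔭.IsPrime]
    (B : Type) [CommRing B] [IsLocalRing B] [Algebra A B] [IsLocalization.AtPrime B 𝔭] [Algebra B K] [IsScalarTower A B K]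
    (q : Fin 2 → A) (hq : Ideal.map (algebraMap A B) (Ideal.span (Set.range q)) = maximalIdeal B)
    (G : K) (cc : Fin p → K) (hcc : ∃ j : Fin p, (j : ℕ) ≠ 0 ∧ cc j ≠ 0)
    (S₀ : B) (hS₀ : S₀ ∈ maximalIdeal B) (hS₀2 : S₀ ∉ maximalIdeal B ^ 2) (a₀ : ℕ) (ha₀ : ¬ p ∣ a₀) (u : B) (hu : IsUnit u)
    (hX : (∑ j : Fin p, cc j ^ p * G ^ (j : ℕ)) = algebraMap B K (u * S₀ ^ a₀)) :
    ∃ g : A, g ∉ 𝔭 ∧ ∀ (𝔮 : Ideal A) [𝔮.IsPrime], g ∉ 𝔮 →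
      ∀ (R : Type) [CommRing R] [IsRegularLocalRing R] [Algebra A R] [IsLocalization.AtPrime R 𝔮] [Algebra R K] [IsScalarTower A R K],
        IsRsopPart (fun j => algebraMap A R (q j)) → Ideal.span (Set.range fun j => algebraMap A R (q j)) = Ideal.map (algebraMap A R) 𝔭 →
        ∃ cc' : Fin p → K, (∃ j : Fin p, (j : ℕ) ≠ 0 ∧ cc' j ≠ 0) ∧
          CleanPermissibleAt p (algebraMap R K) G (Ideal.map (algebraMap A R) 𝔭) := by
  classical
  have hmemP : ∀ x : A, algebraMap A B x ∈ maximalIdeal B ↔ x ∈ 𝔭 := fun x => IsLocalization.AtPrime.to_map_mem_maximal_iff B 𝔭 x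
  have hunitP : ∀ x : A, IsUnit (algebraMap A B x) ↔ x ∉ 𝔭 := fun x => IsLocalization.AtPrime.isUnit_to_map_iff B 𝔭 x
  have hsurj : ∀ z : B, ∃ (x d : A), d ∉ 𝔭 ∧ z * algebraMap A B d = algebraMap A B x := fun z => by
    obtain ⟨⟨x, d⟩, h⟩ := IsLocalization.surj 𝔭.primeCompl z
    exact ⟨x, d, d.2, h⟩
  have hclear : ∀ (z : B) (x d : A), z * algebraMap A B d = algebraMap A B x →
      algebraMap A B d ^ p * z = algebraMap A B (d ^ (p - 1) * x) := by
    intro z x d h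
    have hp1 : p = (p - 1) + 1 := (Nat.sub_add_cancel hp.out.one_le).symm
    rw [map_mul, map_pow, ← h]
    conv_lhs => rw [hp1, pow_succ]
    ring
  have hinjK : Function.Injective (algebraMap A K) := IsFractionRing.injective A K
  -- clear the denominators of `S₀` and `u`
  obtain ⟨n₀, d₀, hd₀, hSd⟩ := hsurj S₀
  obtain ⟨v₀, s₀, hs₀, hus₀⟩ := hsurj u
  have hv₀ : v₀ ∉ 𝔭 := by
    intro h
    have h1 : algebraMap A B v₀ ∈ maximalIdeal B := (hmemP v₀).mpr h
    rw [← hus₀] at h1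
    exact (maximalIdeal.isMaximal B).ne_top (Ideal.eq_top_of_isUnit_mem _ h1 (hu.mul ((hunitP s₀).mpr hs₀)))
  set S : A := d₀ ^ (p - 1) * n₀ with hSdef
  set v : A := s₀ ^ (p - 1) * v₀ with hvdef
  have hSφ : algebraMap A B S = algebraMap A B d₀ ^ p * S₀ := (hclear _ _ _ hSd).symm
  have hvφ : algebraMap A B v = algebraMap A B s₀ ^ p * u := (hclear _ _ _ hus₀).symm
  obtain ⟨dU, hdU⟩ := (hunitP d₀).mpr hd₀
  have hS𝔭 : S ∈ 𝔭 := by rw [← hmemP, hSφ]; exact Ideal.mul_mem_left _ _ hS₀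
  have hS2 : algebraMap A B S ∉ maximalIdeal B ^ 2 := by
    intro h
    apply hS₀2
    have : S₀ = (↑dU⁻¹ : B) ^ p * algebraMap A B S := by
      rw [hSφ, ← mul_assoc, ← mul_pow, ← hdU, Units.inv_mul, one_pow, one_mul]
    rw [this]; exact Ideal.mul_mem_left _ _ h
  -- `φ S = λ₀ φq₀ + λ₁ φq₁` with a unit coefficient
  have hrange : Set.range (fun j => algebraMap A B (q j)) = {algebraMap A B (q 0), algebraMap A B (q 1)} := by
    ext y; simp only [Set.mem_range, Set.mem_insert_iff, Set.mem_singleton_iff]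
    constructor
    · rintro ⟨i, rfl⟩; fin_cases i <;> simp
    · rintro (rfl | rfl) <;> exact ⟨_, rfl⟩
  have hmB : maximalIdeal B = Ideal.span {algebraMap A B (q 0), algebraMap A B (q 1)} := by
    rw [← hq, Ideal.map_span, ← hrange]; congr 1; ext y; simp [Set.mem_range]
  have hSmem : algebraMap A B S ∈ Ideal.span {algebraMap A B (q 0), algebraMap A B (q 1)} := by rw [← hmB, hmemP]; exact hS𝔭
  obtain ⟨lam₀, lam₁, hlam⟩ := Ideal.mem_span_pair.mp hSmem
  have hqm : ∀ j, algebraMap A B (q j) ∈ maximalIdeal B := fun j => by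
    rw [← hq]; exact Ideal.mem_map_of_mem _ (Ideal.subset_span ⟨j, rfl⟩)
  -- clear the denominators of `λ₀, λ₁`
  obtain ⟨l₀, c₀, hc₀, hl₀⟩ := hsurj lam₀
  obtain ⟨l₁, c₁, hc₁, hl₁⟩ := hsurj lam₁
  have hkey : algebraMap A B (c₀ * c₁ * S) = algebraMap A B (c₁ * l₀ * q 0 + c₀ * l₁ * q 1) := by
    simp only [map_mul, map_add, ← hl₀, ← hl₁, ← hlam]; ring
  obtain ⟨c, hc⟩ := (IsLocalization.eq_iff_exists 𝔭.primeCompl B).mp hkey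
  set L : Fin 2 → A := ![(c : A) * (c₁ * l₀), (c : A) * (c₀ * l₁)] with hLdef
  -- some coefficient is off `𝔭`
  obtain ⟨j₀, hLunit⟩ : ∃ j₀ : Fin 2, L j₀ ∉ 𝔭 := by
    by_contra hnone
    push Not at hnone
    have h0 : (c : A) * (c₁ * l₀) ∈ 𝔭 := by simpa [hLdef] using hnone 0
    have h1 : (c : A) * (c₀ * l₁) ∈ 𝔭 := by simpa [hLdef] using hnone 1
    have hl₀𝔭 : l₀ ∈ 𝔭 := ((h𝔭.mem_or_mem h0).resolve_left c.2 |> h𝔭.mem_or_mem).resolve_left hc₁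
    have hl₁𝔭 : l₁ ∈ 𝔭 := ((h𝔭.mem_or_mem h1).resolve_left c.2 |> h𝔭.mem_or_mem).resolve_left hc₀
    -- then `λ_j ∈ 𝔪_B` and `φ S ∈ 𝔪_B²`
    obtain ⟨c₀U, hc₀U⟩ := (hunitP c₀).mpr hc₀
    obtain ⟨c₁U, hc₁U⟩ := (hunitP c₁).mpr hc₁
    have hlam₀ : lam₀ ∈ maximalIdeal B := by
      have : lam₀ = ↑c₀U⁻¹ * algebraMap A B l₀ := by rw [← hl₀, mul_comm lam₀, ← mul_assoc, ← hc₀U, Units.inv_mul, one_mul]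
      rw [this]; exact Ideal.mul_mem_left _ _ ((hmemP l₀).mpr hl₀𝔭)
    have hlam₁ : lam₁ ∈ maximalIdeal B := by
      have : lam₁ = ↑c₁U⁻¹ * algebraMap A B l₁ := by rw [← hl₁, mul_comm lam₁, ← mul_assoc, ← hc₁U, Units.inv_mul, one_mul]
      rw [this]; exact Ideal.mul_mem_left _ _ ((hmemP l₁).mpr hl₁𝔭)
    apply hS2
    rw [← hlam, pow_two]
    exact Ideal.add_mem _ (Ideal.mul_mem_mul hlam₀ (hqm 0)) (Ideal.mul_mem_mul hlam₁ (hqm 1))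
  have hLS : (c : A) * (c₀ * c₁) * S = ∑ i, L i * q i := by
    rw [Fin.sum_univ_two]
    simp only [hLdef, Matrix.cons_val_zero, Matrix.cons_val_one]
    linear_combination hc
  -- the generic divisor
  set E : A := (c : A) * (c₀ * c₁) with hEdef
  have hE𝔭 : E ∉ 𝔭 := fun h => (h𝔭.mem_or_mem h).elim c.2 (fun h' => (h𝔭.mem_or_mem h').elim hc₀ hc₁)
  set D : A := s₀ * d₀ ^ a₀ with hDdef
  have hD𝔭 : D ∉ 𝔭 := fun h => (h𝔭.mem_or_mem h).elim hs₀ (fun h' => hd₀ (h𝔭.mem_of_pow_mem _ h'))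
  refine ⟨E * L j₀ * (s₀ * v₀) * D, ?_, ?_⟩
  · intro h
    rcases h𝔭.mem_or_mem h with h1 | h1
    · rcases h𝔭.mem_or_mem h1 with h2 | h2
      · exact (h𝔭.mem_or_mem h2).elim hE𝔭 hLunit
      · exact (h𝔭.mem_or_mem h2).elim hs₀ hv₀
    · exact hD𝔭 h1
  intro 𝔮 _ hg R _ _ _ _ _ _ hqrsop hqspan
  have hE𝔮 : E ∉ 𝔮 := fun h => hg (by
    have : E * L j₀ * (s₀ * v₀) * D = E * (L j₀ * (s₀ * v₀) * D) := by ring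
    rw [this]; exact Ideal.mul_mem_right _ _ h)
  have hL𝔮 : L j₀ ∉ 𝔮 := fun h => hg (by
    have : E * L j₀ * (s₀ * v₀) * D = L j₀ * (E * (s₀ * v₀) * D) := by ring
    rw [this]; exact Ideal.mul_mem_right _ _ h)
  have hs₀𝔮 : s₀ ∉ 𝔮 := fun h => hg (by
    have : E * L j₀ * (s₀ * v₀) * D = s₀ * (E * L j₀ * v₀ * D) := by ring
    rw [this]; exact Ideal.mul_mem_right _ _ h)
  have hv₀𝔮 : v₀ ∉ 𝔮 := fun h => hg (by
    have : E * L j₀ * (s₀ * v₀) * D = v₀ * (E * L j₀ * s₀ * D) := by ring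
    rw [this]; exact Ideal.mul_mem_right _ _ h)
  have hD𝔮 : D ∉ 𝔮 := fun h => hg (Ideal.mul_mem_left _ _ h)
  set ψ := algebraMap A R with hψ
  have hunitQ : ∀ y : A, y ∉ 𝔮 → IsUnit (ψ y) := fun y hy => (IsLocalization.AtPrime.isUnit_to_map_iff R 𝔮 y).mpr hy
  have hPm : Ideal.map ψ 𝔭 ≤ maximalIdeal R := by rw [← hqspan]; exact hqrsop.span_range_le_maximalIdeal
  -- `(ψ S, ψ q_{j₁})` is a regular pair generating `𝔭 A_𝔮`
  obtain ⟨j₁, hj₁⟩ : ∃ j₁ : Fin 2, j₀ ≠ j₁ := ⟨j₀ + 1, by fin_cases j₀ <;> simp⟩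
  obtain ⟨EU, hEU⟩ := hunitQ E hE𝔮
  set μ : Fin 2 → R := fun i => ↑EU⁻¹ * ψ (L i) with hμdef
  have hμS : (∑ i, (μ i + (fun _ : Fin 2 => (0 : R)) i) * ψ (q i)) = ψ S := by
    have h1 : ψ E * ψ S = ∑ i, ψ (L i) * ψ (q i) := by
      rw [← map_mul, hLS, map_sum]; exact Finset.sum_congr rfl fun i _ => by rw [map_mul]
    have h2 : ψ S = ↑EU⁻¹ * (ψ E * ψ S) := by rw [← mul_assoc, ← hEU, Units.inv_mul, one_mul]
    rw [h2, h1, Finset.mul_sum]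
    exact Finset.sum_congr rfl fun i _ => by simp only [hμdef, add_zero]; ring
  have hμunit : IsUnit (μ j₀) := (Units.isUnit _).mul (hunitQ _ hL𝔮)
  obtain ⟨-, hpair⟩ := span_pair_eq_of_unit_coeff hqrsop hqspan hPm μ (fun _ => 0) (fun _ => Ideal.zero_mem _) hj₁ hμunit
  rw [hμS] at hpair
  have hSrsop : IsRsopPart ![ψ S] := by
    have := hpair.comp (fun _ : Fin 1 => (0 : Fin 2)) (fun _ _ _ => Subsingleton.elim _ _)
    convert this using 1
    ext i; fin_cases i; rfl
  have hSJ : ∀ k : Fin 1, (![ψ S] : Fin 1 → R) k ∈ Ideal.map ψ 𝔭 := fun k => by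
    fin_cases k; exact Ideal.mem_map_of_mem _ hS𝔭
  haveI : IsRegularLocalRing (R ⧸ Ideal.map ψ 𝔭) := by rw [← hqspan]; exact hqrsop.isRegularLocalRing_quotient
  -- the representative, rescaled by `D^p`
  have hRφ : algebraMap A B (v * S ^ a₀) = algebraMap A B D ^ p * (u * S₀ ^ a₀) := by
    rw [map_mul, hvφ, map_pow, hSφ, hDdef, map_mul, map_pow, mul_pow, ← pow_mul, mul_pow, ← pow_mul, mul_comm a₀ p]; ring
  have hDK : algebraMap A K D ≠ 0 := fun h0 => hD𝔭 (by rw [(injective_iff_map_eq_zero _).mp hinjK D h0]; exact 𝔭.zero_mem)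
  obtain ⟨hcc', hX'⟩ := rep_scale_mul_pow p G cc hcc (algebraMap A K D) _ hDK hX
  have hXR : (∑ j : Fin p, (fun j => cc j * algebraMap A K D) j ^ p * G ^ (j : ℕ)) =
      algebraMap R K (ψ v * (∏ k : Fin 1, (![ψ S] : Fin 1 → R) k ^ (![a₀] : Fin 1 → ℕ) k) *
        ∏ k : Fin 0, (Fin.elim0 k : R) ^ (Fin.elim0 k : ℕ)) := by
    rw [hX', Fin.prod_univ_zero, mul_one, Fin.prod_univ_one]
    simp only [Matrix.cons_val_zero]
    have h1 : algebraMap A K D ^ p * algebraMap B K (u * S₀ ^ a₀) = algebraMap A K (v * S ^ a₀) := by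
      rw [IsScalarTower.algebraMap_apply A B K D, ← map_pow, ← map_mul, ← hRφ, ← IsScalarTower.algebraMap_apply]
    rw [h1, IsScalarTower.algebraMap_apply A R K]
    simp [map_mul, map_pow, hψ]
  refine ⟨_, hcc', ?_⟩
  refine cleanPermissibleAt_of_split p (algebraMap R K) G (Ideal.map ψ 𝔭) _ hcc' ![ψ S] Fin.elim0 hSrsop hSJ
    (fun k => Fin.elim0 k) ?_ ![a₀] Fin.elim0 (Or.inl ⟨0, by simpa using ha₀⟩) (ψ v) ?_ hXR
  · haveI : IsLocalRing (R ⧸ Ideal.map ψ 𝔭) := inferInstance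
    refine ⟨inferInstance, (maximalIdeal (R ⧸ Ideal.map ψ 𝔭)).spanFinrank,
      Classical.choose (exists_regularSystemOfParameters (R := R ⧸ Ideal.map ψ 𝔭)), ?_, ?_⟩
    · rw [zero_add]; exact (IsRegularLocalRing.spanFinrank_maximalIdeal (R := R ⧸ Ideal.map ψ 𝔭)).symm
    · rw [Set.range_eq_empty, Set.empty_union]
      exact Classical.choose_spec (exists_regularSystemOfParameters (R := R ⧸ Ideal.map ψ 𝔭))
  · rw [hvdef, map_mul, map_pow]
    exact ((hunitQ s₀ hs₀𝔮).pow _).mul (hunitQ v₀ hv₀𝔮)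

end Summit.ResolutionOfSingularities.ResolutionOfSingularities.Theorems.RadicialJung.CleanModels

end
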